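import Summits.QuantumFields.YangMills.Theorems.UnitScaleTiltProp7SmoothUntwistSocket
import HarnessLib

/-!
# Route `UnitScaleTilt`, crux K1 «MinimiserStabilityRegPr» (stmt-QuantumFields-19200), route-R E′ path (α′), (E1) «pinned slice theorem» — its STARTING POINT (row R2 ∕ (F1′)):
# THE DATUM OF THE EXACT CORRECTOR — the smooth untwisted chart read as the `D : Fin d → Site → M₂(ℂ)` of ✓ `Prop7ExactCorrectorMember.exists_exact_corrector_member`, with ITS two
# datum rows: reality `(D μ x)ᴴ = D μ x ∧ tr (D μ x) = 0` and `hD : max (ℓ·‖D‖) (ℓ²·‖fun x => divB 𝒰 D x‖) ≤ s_*`, `ℓ = (F.L : ℝ)^(K−n)` (the member door's letter)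

Cell `ym3-torus`, width seat `ym-ust-19200-w1` (gen 12); LOCATE `LOCATE-F1PRIME-SMOOTH-UNTWIST-w1g12.md` (19200 evidence n = 55), file (U6) — the junction of ✓ `Prop7SmoothUntwistSocket` (U5) to
ym3-torus-px13's member door ✓ `Prop7ExactCorrectorMember`.  THEOREMS ONLY (0 `def`, 0 `sorry`); `--supports stmt-QuantumFields-19200`, count-neutral.  YM₃ on T³ is a ladder rung (R3),
not the Clay problem; nothing here claims a stub, the crux, d = 4 or the mass gap; (E1) is NOT closed by this file.

WHY.  ✓ `exists_exact_corrector_member` takes the datum as `D : Fin (F.P K).d → Site (F.P K) 0 → M₂(ℂ)` with the rows `(∀ μ x, (D μ x)ᴴ = D μ x ∧ (D μ x).trace = 0)` and `q D ≤ s`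
for any size `q` dominating `((F.L : ℝ)^(K−n))²·‖fun x => divB 𝒰 D x‖`; the knit's `q` is `max (ℓ·‖·‖) (ℓ²·‖divB 𝒰 ·‖)`.  (U5) delivers the untwisted chart as a `PBond`-function with
`Pi`-norm rows in the letter `((F.P K).L^(K−n) : ℕ)`; THIS FILE re-indexes (`D μ z := D‴ ⟨z, μ⟩`, `fun b => D b.dir b.src = D‴` by structure eta), rewrites the block letter to
`(F.L : ℝ)^(K−n)`, and packages the two rows as ONE `max`-inequality — so the (E1-e) knit's `hD` is `exact` this, with `s_* := max S₁ S₂` explicit in print's `s₀ s₁′ σ` and the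
frame constants `c₀ c₁` (= `C′e^{C′}` at the member, ✓ `exists_smoothUntwistedChart_of_regPr_T3`).

WHAT IS PROVED (ns `…Theorems.Prop7SmoothUntwistDatum`).
* `blockLetter_eq` — `((((F.P K).L ^ (K−n) : ℕ)) : ℝ) = (F.L : ℝ) ^ (K−n)`.
* ★★★ `exists_datum_of_smoothUntwist_T3` — `∃ D : Fin d → Site → M₂(ℂ)`, reality rows ∧ `max (ℓ‖D‖) (ℓ²‖divB 𝒰 D‖) ≤ max S₁ S₂` ∧ `A((e^{iA₀}W)^u) = A(e^{iD}W)` ∧ `e^{iD}W ∈ (6)(e) ∩ 𝔅_k(V)`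
  (`e^{iD}W := emb15 W (expHermField fun b => D b.dir b.src)`), `S₁ = s₀ + (1+2s₀)(1+6σ)K₁`, `S₂ = s₁′ + d(K₂ + 9K₁² + 36σK₂) + d(6K₁s₀ + 4s₀(1+6σ)K₁)`.
HONEST SCOPE.  Re-indexing and one `max`; displayed exactly what (U5) displays.

References: T. Bałaban, CMP 102 (1985) 277–309 [Balaban1985Variational] (Prop. 7 p.299, (15) p.280); CMP 99 (1985) 75–102 [Balaban1985RegularSpaces] ((1.36) p.82, (1.72) p.88).
-/

set_option autoImplicit false

noncomputable section

open scoped BigOperators Matrix.Norms.L2Operator Matrix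

namespace Summit.QuantumFields.YangMills.Theorems.Prop7SmoothUntwistDatum

open Literature.MathematicalPhysics.QuantumFieldTheory.Balaban1983to89
open Literature.MathematicalPhysics.QuantumFieldTheory.Balaban1983to89.T3ContinuumYM3Torus
open Literature.MathematicalPhysics.QuantumFieldTheory.Balaban1983to89.T3PrintedRegularMinimiser (regFibrePr)
open Literature.MathematicalPhysics.QuantumFieldTheory.Balaban1983to89.T3SectALandauChart (emb15)
open T4Continuum
open B9Eq39Adjoint (divB)
open B9TorusCalculus (torusT)
open B10Eq27TorusAxialLog (unitsField toUField)
open B5Eq118OneStroke (iterBlockOf)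
open B15DeterminingSets (embIter)
open Summit.QuantumFields.YangMills.Theorems.Prop7TPrint (expHermField)
open Summit.QuantumFields.YangMills.Theorems.Prop7SmoothUntwistSocket (exists_smoothUntwistedChart_socket_T3)

/-- The block letter of (U1)–(U5) is the member door's: `↑((F.P K).L ^ (K−n)) = (F.L : ℝ) ^ (K−n)`. [cite: Balaban1985RegularSpaces, (1.36) p.82 (bookkeeping)] -/
theorem blockLetter_eq (F : T3Family) (K n : ℕ) : ((((F.P K).L ^ (K - n) : ℕ)) : ℝ) = ((F.L : ℝ) ^ (K - n)) := by
  push_cast; rfl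

/-- ★★★ **THE DATUM OF THE EXACT CORRECTOR FROM THE SMOOTH UNTWISTING** — hypotheses of ✓ `exists_smoothUntwistedChart_socket_T3` verbatim; conclusion in the letters of
✓ `Prop7ExactCorrectorMember.exists_exact_corrector_member`: `∃ D : Fin d → Site → M₂(ℂ)` with the reality rows, `max (ℓ·‖D‖) (ℓ²·‖fun x => divB 𝒰 D x‖) ≤ max S₁ S₂` (`ℓ = (F.L:ℝ)^(K−n)`),
the action of `(e^{iA₀}W)^u` and membership of `e^{iD}W` in the fibre. [cite: Balaban1985Variational, Prop. 7 p.299, (15) p.280; Balaban1985RegularSpaces, (1.36) p.82, (1.72) p.88] -/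
theorem exists_datum_of_smoothUntwist_T3 (F : T3Family) {n K : ℕ} (h : n ≤ K) (hk1 : 1 ≤ K - n) {e s₀ s₁' σ a₀ a₁ c₀ c₁ : ℝ} (he : 0 ≤ e)
    {V : GaugeField (F.P n) 0 (Matrix.specialUnitaryGroup (Fin 2) ℂ)} (W : GaugeField (F.P K) 0 (Matrix.specialUnitaryGroup (Fin 2) ℂ))
    (A₀ : PBond (F.P K) 0 → Matrix (Fin 2) (Fin 2) ℂ) (hA0 : ∀ b, (A₀ b).IsHermitian ∧ Matrix.trace (A₀ b) = 0)
    (hs₀ : ((((F.P K).L ^ (K - n) : ℕ)) : ℝ) * ‖(fun (μ : Fin (F.P K).d) (z : Site (F.P K) 0) => A₀ ⟨z, μ⟩)‖ ≤ s₀) (hs₀' : s₀ ≤ 1 / 64)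
    (hs₁ : ((((F.P K).L ^ (K - n) : ℕ)) : ℝ) ^ 2 * ‖(fun x => divB (torusT (F.P K) 0) (fun κ z => unitsField (toUField W) ⟨z, κ⟩) (fun μ z => A₀ ⟨z, μ⟩) x)‖ ≤ s₁')
    (u : GaugeTransf (F.P K) 0 (Matrix.specialUnitaryGroup (Fin 2) ℂ)) (hXu : GaugeField.gaugeAct u (emb15 W (expHermField A₀)) ∈ regFibrePr F n K h e V)
    (hσ : ∀ y : Site (F.P K) (K - n), dist1 (u (embIter (K - n) y)) ≤ σ) (hσ0 : σ ≤ 1 / 1024) (hσc : ((6 + 2 * c₀) * (2 * σ)) ≤ 1 / 256)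
    (Fr : Site (F.P K) (K - n) → Site (F.P K) 0 → (Matrix (Fin 2) (Fin 2) ℂ)ˣ)
    (hFr : ∀ y z, ‖(Fr y z : Matrix (Fin 2) (Fin 2) ℂ)‖ ≤ 1 ∧ ‖(((Fr y z)⁻¹ : (Matrix (Fin 2) (Fin 2) ℂ)ˣ) : Matrix (Fin 2) (Fin 2) ℂ)‖ ≤ 1) (hFr1 : ∀ y, Fr y (embIter (K - n) y) = 1)
    (ha₀ : 0 ≤ a₀) (ha₁ : 0 ≤ a₁) (hc₀ : ((((F.P K).L ^ (K - n) : ℕ)) : ℝ) * a₀ ≤ c₀) (hc₁ : ((((F.P K).L ^ (K - n) : ℕ)) : ℝ) ^ 2 * a₁ ≤ c₁)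
    (hA : ∀ (y : Site (F.P K) (K - n)) (z : Site (F.P K) 0), (∀ ν : Fin (F.P K).d, (y ν = (iterBlockOf (K - n) (fun κ => z κ - (((((F.P K).L ^ (K - n) - 1) / 2 : ℕ)) : ZMod ((F.P K).sitesPerDir 0)))) ν - 1 ∨ y ν = (iterBlockOf (K - n) (fun κ => z κ - (((((F.P K).L ^ (K - n) - 1) / 2 : ℕ)) : ZMod ((F.P K).sitesPerDir 0)))) ν ∨ y ν = (iterBlockOf (K - n) (fun κ => z κ - (((((F.P K).L ^ (K - n) - 1) / 2 : ℕ)) : ZMod ((F.P K).sitesPerDir 0)))) ν + 1 ∨ y ν = (iterBlockOf (K - n) (fun κ => z κ - (((((F.P K).L ^ (K - n) - 1) / 2 : ℕ)) : ZMod ((F.P K).sitesPerDir 0)))) ν + 2)) → ∀ μ : Fin (F.P K).d,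
      ‖(((Fr y z)⁻¹ * unitsField (toUField W) ⟨z, μ⟩ * Fr y (torusT (F.P K) 0 μ z) : (Matrix (Fin 2) (Fin 2) ℂ)ˣ) : Matrix (Fin 2) (Fin 2) ℂ) - 1‖ ≤ a₀
      ∧ ‖(((Fr y ((torusT (F.P K) 0 μ).symm z))⁻¹ * unitsField (toUField W) ⟨(torusT (F.P K) 0 μ).symm z, μ⟩ * Fr y z : (Matrix (Fin 2) (Fin 2) ℂ)ˣ) : Matrix (Fin 2) (Fin 2) ℂ) - 1‖ ≤ a₀
      ∧ ‖(((Fr y z)⁻¹ * unitsField (toUField W) ⟨z, μ⟩ * Fr y (torusT (F.P K) 0 μ z) : (Matrix (Fin 2) (Fin 2) ℂ)ˣ) : Matrix (Fin 2) (Fin 2) ℂ)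
          - (((Fr y ((torusT (F.P K) 0 μ).symm z))⁻¹ * unitsField (toUField W) ⟨(torusT (F.P K) 0 μ).symm z, μ⟩ * Fr y z : (Matrix (Fin 2) (Fin 2) ℂ)ˣ) : Matrix (Fin 2) (Fin 2) ℂ)‖ ≤ a₁) :
    ∃ D : Fin (F.P K).d → Site (F.P K) 0 → Matrix (Fin 2) (Fin 2) ℂ,
      (∀ μ x, (D μ x)ᴴ = D μ x ∧ (D μ x).trace = 0) ∧
      max (((F.L : ℝ) ^ (K - n)) * ‖D‖) (((F.L : ℝ) ^ (K - n)) ^ 2 * ‖(fun x => divB (torusT (F.P K) 0) (fun κ z => unitsField (toUField W) ⟨z, κ⟩) D x)‖) ≤ max (s₀ + (1 + 2 * s₀) * ((1 + 6 * σ) * ((6 + 2 * c₀) * (2 * σ)))) (s₁' + ((F.P K).d : ℝ) * (((2 * (c₁ + 2 * c₀ ^ 2) + 24 * c₀ + 24) * (2 * σ)) + 9 * ((6 + 2 * c₀) * (2 * σ)) ^ 2 + 36 * σ * ((2 * (c₁ + 2 * c₀ ^ 2) + 24 * c₀ + 24) * (2 * σ))) + ((F.P K).d : ℝ) * (6 *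 ((6 + 2 * c₀) * (2 * σ)) * s₀ + 4 * s₀ * ((1 + 6 * σ) * ((6 + 2 * c₀) * (2 * σ))))) ∧
      wilsonAction4 (GaugeField.gaugeAct u (emb15 W (expHermField A₀))) = wilsonAction4 (emb15 W (expHermField fun b => D b.dir b.src)) ∧
      emb15 W (expHermField fun b => D b.dir b.src) ∈ regFibrePr F n K h e V := by
  obtain ⟨D, hD1, hD2, hD3, hD4, hD5⟩ := exists_smoothUntwistedChart_socket_T3 F h hk1 he W A₀ hA0 hs₀ hs₀' hs₁ u hXu hσ hσ0 hσc Fr hFr hFr1 ha₀ ha₁ hc₀ hc₁ hA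
  have hb : (fun b : PBond (F.P K) 0 => (fun (μ : Fin (F.P K).d) (z : Site (F.P K) 0) => D ⟨z, μ⟩) b.dir b.src) = D := by
    funext b; rfl
  refine ⟨fun μ z => D ⟨z, μ⟩, fun μ x => ⟨(hD1 ⟨x, μ⟩).1.eq, (hD1 ⟨x, μ⟩).2⟩, ?_, ?_, ?_⟩
  · rw [← blockLetter_eq]
    exact max_le_max hD2 hD3
  · rw [hb]; exact hD4
  · rw [hb]; exact hD5

end Summit.QuantumFields.YangMills.Theorems.Prop7SmoothUntwistDatum

end
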